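import Literature.NumberTheory.IwasawaTheory.ClassicalMuVanishesUnramifiedClassesProofs
import Literature.NumberTheory.EllipticCurves.SubgroupSelmerCocycleCriteriaProofs
import HarnessLib

/-!
# A `Γ`-stable `p`-torsion subgroup of `H¹(Gal(K̄/K_∞), M)` is FINITE as soon as its classes fixed by `γ^{pⁿ}`
# are bounded by `p^{a n + b}`; and restriction to a subgroup of index prime to `p` is injective on `H¹`
# (two generic lemmas; proved, no definition, no named fact)

Topic `NumberTheory/IwasawaTheory` (namespace `Literature.NumberTheory.IwasawaTheory.ZpTowerFiniteOfLayerCardBound`).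
THEOREM-ONLY file written by the prover seat `bsd-eis-lam-a` g20 (cell `bsd-eis`; `--supports`
stmt-BirchSwinnertonDyer-19035, crux 5 `MazurMCOnX1RankZero`, registered stub `stub_publishedL59` = Greenberg's
Lemma 5.9; closes nothing).  Two ingredients of the discharge of Greenberg, LNM 1716, Lemma 5.9 modulo
Ferrero–Washington, abstracted from the objects of that lemma:

* §1 **`resOfLe_injective_of_index_coprime`** — for subgroups `H₁ ≤ H₂` of a topological group with `H₁` normal in
  `H₂` of finite index prime to `p`, and a discrete `p`-torsion module `M` on which `H₁` acts trivially, the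
  restriction `H¹(H₂, M) → H¹(H₁, M)` is INJECTIVE: a cocycle vanishing on `H₁` factors through the finite quotient
  `Q = H₂/H₁`, and averaging (`v = −d⁻¹ Σ_{q ∈ Q} z(q̃)`, `d = #Q` invertible modulo `p`) exhibits it as a
  coboundary (the inflation–restriction sequence with `H¹(Q, M) = 0` for `#Q` prime to `p`, Serre I §2.6 and
  the Corollary to Prop. 8 of I §2.4, done on cocycles).
* §2 **`finite_of_card_fixedBy_le_pow`** — for a `ℤ_p`-extension `κ` of a number field `K` (topological
  generator `γ`), a discrete `Γ_K`-module `M` with continuous action and `p·M = 0`, and an additive subgroup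
  `S ≤ H¹(ker κ, M)` stable under `conj_γ`: if for all `N ≥ n₀` every finite set of classes of `S` fixed by
  `conj_{γ^{p^N}}` has at most `p^{a N + b}` elements, then `S` is finite.  This is the skeleton of the tree's
  proof of Iwasawa's `μ = 0` in character form (`ClassicalMuVanishesUnramifiedClassesProofs`, rkm g34: the
  locally nilpotent operator `T = conj_γ − 1`, `T^{pⁿ} = conj_{γ^{pⁿ}} − 1` on `p`-torsion classes, strictly
  increasing kernel chain `#ker T^j ≥ 2^j` if `S` were infinite, against `2^{p^N} > p^{aN+b}`), with the
  class-number count replaced by an abstract layer bound — so that the SAME skeleton serves modules with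
  non-trivial action (Greenberg's `Θ` of order `p`) and other local conditions (unramified outside `p`).

References: [GreenbergLNM1716] §1 (every class is killed by some `Tⁿ`), §3 Lemma 3.2, §5 Lemma 5.9;
[SerreGaloisCohomology1997] I §2.4 (Cor. to Prop. 8), I §2.6 (b); [Washington1997] §13.3.
-/

set_option autoImplicit false

noncomputable section

open scoped Classical Pointwise NumberField

namespace Literature.NumberTheory.IwasawaTheory.ZpTowerFiniteOfLayerCardBound

open Field Literature.NumberTheory.EllipticCurves Literature.NumberTheory.EllipticCurves.GreenbergSelmer
  Literature.NumberTheory.GaloisRepresentations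
  Literature.NumberTheory.IwasawaTheory.ClassicalMuVanishesUnramifiedClasses

universe u

/-! ## §1 Restriction to a normal subgroup of index prime to `p` is injective -/

/-- Arithmetic: an integer prime to `p` is invertible on a `p`-torsion abelian group (private helper). [folklore] -/
private theorem exists_mul_nsmul_eq_self {M : Type*} [AddCommGroup M] {p d : ℕ} (hp : p.Prime) (hcop : d.Coprime p)
    (hpM : ∀ m : M, p • m = 0) : ∃ u : ℕ, ∀ m : M, (u * d) • m = m := by
  -- `u d ≡ 1 (mod p)`
  have h1 : ∃ u : ℕ, u * d % p = 1 := by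
    have hu : IsUnit ((d : ZMod p)) := (ZMod.isUnit_iff_coprime d p).mpr hcop
    haveI : Fact p.Prime := ⟨hp⟩
    obtain ⟨w, hw⟩ := hu
    refine ⟨(w⁻¹ : (ZMod p)ˣ).val.val, ?_⟩
    have h : (((w⁻¹ : (ZMod p)ˣ).val.val * d : ℕ) : ZMod p) = 1 := by
      rw [Nat.cast_mul, ZMod.natCast_zmod_val, ← hw, Units.inv_mul]
    have h' := congrArg ZMod.val h
    rw [ZMod.val_natCast, ZMod.val_one] at h'
    exact h'
  obtain ⟨u, hu⟩ := h1
  refine ⟨u, fun m => ?_⟩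
  conv_lhs => rw [← Nat.div_add_mod (u * d) p, hu, add_smul, mul_smul, hpM, one_smul, zero_add]

section InjRes

variable {G : Type u} [Group G] [TopologicalSpace G] [IsTopologicalGroup G]
  {M : Type u} [AddCommGroup M] [DistribMulAction G M] [TopologicalSpace M] [DiscreteTopology M]

/-- **Restriction to a normal subgroup of index prime to `p` is injective on `H¹` of a `p`-torsion module fixed
by the subgroup.**  `H₁ ≤ H₂ ≤ G`, `H₁` normal in `H₂` with `[H₂ : H₁]` prime to `p`, `M` a discrete `G`-module with
`p·M = 0` on which `H₁` acts trivially: `res : H¹(H₂, M) → H¹(H₁, M)` is injective.  (Inflation–restriction: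
the kernel is `H¹(H₂/H₁, M) = 0`; here on cocycles — a cocycle vanishing on `H₁` is a function on the finite
quotient and the average of its values trivialises it.)
[cite: SerreGaloisCohomology1997, I §2.6 (b) and I §2.4 (Cor. to Prop. 8)] -/
theorem resOfLe_injective_of_index_coprime {H₁ H₂ : Subgroup G} (hle : H₁ ≤ H₂)
    [hN : (H₁.subgroupOf H₂).Normal] {p : ℕ} (hp : p.Prime)
    (hcop : (H₁.subgroupOf H₂).index.Coprime p) (hpM : ∀ m : M, p • m = 0)
    (htriv : ∀ (x : G), x ∈ H₁ → ∀ m : M, x • m = m) :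
    Function.Injective (resOfLe M hle : subgroupH1 H₂ M →+ subgroupH1 H₁ M) := by
  classical
  set N : Subgroup H₂ := H₁.subgroupOf H₂ with hNdef
  have hidx : N.index ≠ 0 := by
    intro h0
    rw [hNdef] at h0
    rw [h0, Nat.coprime_zero_left] at hcop
    exact hp.one_lt.ne' hcop
  haveI : N.FiniteIndex := ⟨hidx⟩
  haveI : Finite (H₂ ⧸ N) := Subgroup.finite_quotient_of_finiteIndex
  haveI : Fintype (H₂ ⧸ N) := Fintype.ofFinite _
  obtain ⟨u, hu⟩ := exists_mul_nsmul_eq_self (M := M) hp hcop hpM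
  rw [injective_iff_map_eq_zero]
  intro c hc
  obtain ⟨z, rfl⟩ := oneCocycleClass_surjective _ c
  -- `z` vanishes on `H₁`
  rw [CocycleCriteria.resOfLe_oneCocycleClass_eq_zero_iff] at hc
  obtain ⟨a, ha⟩ := hc
  have hz1 : ∀ y : H₂, (y : G) ∈ H₁ → z.1 y = 0 := by
    intro y hy
    have h := ha ⟨(y : G), hy⟩
    have e : Subgroup.inclusion hle ⟨(y : G), hy⟩ = y := Subtype.ext rfl
    rw [e] at h
    rw [h, htriv _ hy, sub_self]
  -- the cocycle identity and constancy on cosets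
  have hcoc : ∀ x y : H₂, z.1 (x * y) = z.1 x + (x : G) • z.1 y := fun x y => z.2 x y
  have hconst : ∀ (y : H₂) (n : H₂), n ∈ N → z.1 (y * n) = z.1 y := by
    intro y n hn
    rw [hcoc, hz1 n (Subgroup.mem_subgroupOf.mp hn), smul_zero, add_zero]
  have hout : ∀ (τ : H₂) (q : H₂ ⧸ N),
      z.1 (τ * q.out) = z.1 (((QuotientGroup.mk τ : H₂ ⧸ N) * q).out) := by
    intro τ q
    have hrel : (((QuotientGroup.mk τ : H₂ ⧸ N) * q).out)⁻¹ * (τ * q.out) ∈ N := by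
      rw [← QuotientGroup.eq, QuotientGroup.out_eq', QuotientGroup.mk_mul, QuotientGroup.out_eq']
    have e : τ * q.out = ((QuotientGroup.mk τ : H₂ ⧸ N) * q).out *
        ((((QuotientGroup.mk τ : H₂ ⧸ N) * q).out)⁻¹ * (τ * q.out)) := by
      rw [mul_inv_cancel_left]
    rw [e, hconst _ _ hrel]
  -- the average
  set m₀ : M := ∑ q : H₂ ⧸ N, z.1 q.out with hm₀
  have hkey : ∀ τ : H₂, (τ : G) • m₀ + Fintype.card (H₂ ⧸ N) • z.1 τ = m₀ := by
    intro τ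
    have h1 : (τ : G) • m₀ = ∑ q : H₂ ⧸ N, (z.1 (τ * q.out) - z.1 τ) := by
      rw [hm₀, Finset.smul_sum]
      refine Finset.sum_congr rfl fun q _ => ?_
      rw [hcoc, add_sub_cancel_left]
    rw [h1, Finset.sum_sub_distrib, Finset.sum_const, Finset.card_univ, sub_add_cancel]
    rw [show (∑ q : H₂ ⧸ N, z.1 (τ * q.out)) =
        ∑ q : H₂ ⧸ N, z.1 (((QuotientGroup.mk τ : H₂ ⧸ N) * q).out) from
      Finset.sum_congr rfl fun q _ => hout τ q]
    exact Fintype.sum_equiv (Equiv.mulLeft (QuotientGroup.mk τ : H₂ ⧸ N)) _ _ fun q => rfl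
  -- `z` is the coboundary of `v = -(u • m₀)`
  rw [oneCocycleClass_eq_zero_iff]
  refine ⟨-(u • m₀), fun τ => ?_⟩
  rw [discreteTopRep_ρ_apply, Subgroup.smul_def, smul_neg, sub_neg_eq_add]
  have hd : Fintype.card (H₂ ⧸ N) = N.index := by
    rw [Subgroup.index_eq_card, Nat.card_eq_fintype_card]
  have h2 : z.1 τ = u • (Fintype.card (H₂ ⧸ N) • z.1 τ) := by
    rw [← mul_smul, hd, hu]
  have h3 : Fintype.card (H₂ ⧸ N) • z.1 τ = m₀ - (τ : G) • m₀ := by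
    rw [eq_sub_iff_add_eq, add_comm]; exact hkey τ
  rw [h2, h3, smul_sub, smul_comm u (τ : G) m₀]
  abel

end InjRes

/-! ## §2 Finiteness along a `ℤ_p`-tower from a layer bound -/

section Tower

variable {K : Type} [Field K] [NumberField K] {p : ℕ} [Fact p.Prime] (κ : ZpExtension K p)
variable {M : Type} [AddCommGroup M] [DistribMulAction (absoluteGaloisGroup K) M] [TopologicalSpace M]
  [DiscreteTopology M]

/-- Arithmetic: a linear function is eventually below `2^N` (private helper, as in the `μ = 0` file). [folklore] -/
private theorem exists_le_and_mul_add_lt_two_pow (a b n₁ : ℕ) : ∃ N : ℕ, n₁ ≤ N ∧ a * N + b < 2 ^ N := by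
  set c := a + b + n₁ + 1 with hc
  have hc1 : 1 ≤ c := by omega
  have key : ∀ d : ℕ, 1 ≤ d → 3 * (d * d) < 4 ^ d := by
    intro d hd
    induction d with
    | zero => omega
    | succ d ih =>
      rcases Nat.eq_zero_or_pos d with rfl | hdpos
      · norm_num
      · have ih' := ih hdpos
        have h4 : 4 ^ (d + 1) = 4 ^ d * 4 := pow_succ 4 d
        rw [h4]
        nlinarith [ih']
  refine ⟨2 * c, by omega, ?_⟩
  have h1 : a * (2 * c) + b ≤ 3 * (c * c) := by nlinarith
  calc a * (2 * c) + b ≤ 3 * (c * c) := h1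
    _ < 4 ^ c := key c hc1
    _ = 2 ^ (2 * c) := by rw [pow_mul]; norm_num

/-- **Finiteness from a layer bound.** `κ` a `ℤ_p`-extension of the number field `K` with topological generator
`γ`, `M` a discrete `Γ_K`-module with continuous action and `p·M = 0`, `S ≤ H¹(ker κ, M)` an additive subgroup
stable under `conj_γ`.  If there are `a b n₀` such that for every `N ≥ n₀` every finite set of classes of `S`
fixed by `conj_{γ^{p^N}}` has at most `p ^ (a N + b)` elements, then `S` is finite.  (Greenberg: every class
is killed by `T^{pⁿ}` for some `n`, `T = conj_γ − 1`; on `p`-torsion classes `T^{pⁿ} = conj_{γ^{pⁿ}} − 1`; an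
infinite `S` would give `#ker T^{p^N} ≥ 2^{p^N} > p^{aN+b}`.)
[cite: GreenbergLNM1716, §1 (after Conj. 1.3) and §3 Lemma 3.2] [cite: Washington1997, §13.3 (proof of Thm. 13.13)] -/
theorem finite_of_card_fixedBy_le_pow
    (hcont : ∀ m : M, Continuous fun g : absoluteGaloisGroup K => g • m)
    (hpM : ∀ m : M, p • m = 0) {γ : absoluteGaloisGroup K} (hγ : κ.IsTopGenerator γ)
    (S : AddSubgroup (subgroupH1 κ.kerSubgroup M))
    (hS : ∀ c ∈ S, conjH1 κ.kerSubgroup M γ c ∈ S)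
    {a b n₀ : ℕ}
    (hbound : ∀ N : ℕ, n₀ ≤ N → ∀ F : Finset (subgroupH1 κ.kerSubgroup M),
      (∀ c ∈ F, c ∈ S ∧ conjH1 κ.kerSubgroup M (γ ^ p ^ N) c = c) → F.card ≤ p ^ (a * N + b)) :
    (S : Set (subgroupH1 κ.kerSubgroup M)).Finite := by
  have hpr : p.Prime := Fact.out
  -- UPPER BOUND: the classes of `S` fixed by `γ^{p^N}` form a finite set of bounded size
  have hupper : ∀ N : ℕ, n₀ ≤ N →
      {c : subgroupH1 κ.kerSubgroup M | c ∈ S ∧ conjH1 κ.kerSubgroup M (γ ^ p ^ N) c = c}.Finite ∧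
        Nat.card {c : subgroupH1 κ.kerSubgroup M | c ∈ S ∧ conjH1 κ.kerSubgroup M (γ ^ p ^ N) c = c} ≤ p ^ (a * N + b) := by
    intro N hN
    have hbd : ∀ F : Finset (subgroupH1 κ.kerSubgroup M),
        (↑F ⊆ {c : subgroupH1 κ.kerSubgroup M | c ∈ S ∧ conjH1 κ.kerSubgroup M (γ ^ p ^ N) c = c}) →
          F.card ≤ p ^ (a * N + b) := fun F hF => hbound N hN F (fun c hc => hF hc)
    have hfin : {c : subgroupH1 κ.kerSubgroup M | c ∈ S ∧ conjH1 κ.kerSubgroup M (γ ^ p ^ N) c = c}.Finite := by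
      by_contra hinf
      obtain ⟨F, hFsub, hFcard⟩ := Set.Infinite.exists_subset_card_eq hinf (p ^ (a * N + b) + 1)
      have := hbd F hFsub
      omega
    refine ⟨hfin, ?_⟩
    rw [Nat.card_coe_set_eq, Set.ncard_eq_toFinset_card _ hfin]
    exact hbd _ (by simp)
  -- every class of `S` is `p`-torsion
  have hSp : ∀ c : subgroupH1 κ.kerSubgroup M, (p : ℤ) • c = 0 := fun c => by
    rw [natCast_zsmul]
    have h := FineSelmerRestrictionDescent.nsmul_subgroupH1_eq_zero κ.kerSubgroup (n := p ^ 1)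
      (fun m => by rw [pow_one]; exact hpM m) c
    rwa [pow_one] at h
  -- the operator `T = conj_γ − 1`
  set Φ : AddMonoid.End (subgroupH1 κ.kerSubgroup M) := conjH1 κ.kerSubgroup M γ with hΦ
  set T : AddMonoid.End (subgroupH1 κ.kerSubgroup M) := Φ - 1 with hT
  have hTapply : ∀ c, T c = conjH1 κ.kerSubgroup M γ c - c := fun c => rfl
  have hTmem : ∀ c ∈ S, T c ∈ S := fun c hc => by
    rw [hTapply]; exact S.sub_mem (hS c hc) hc
  have hTsucc : ∀ (j : ℕ) (c : subgroupH1 κ.kerSubgroup M), (T ^ (j + 1)) c = T ((T ^ j) c) := fun j c => by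
    rw [pow_succ', AddMonoid.End.coe_mul, Function.comp_apply]
  have hTsucc' : ∀ (j : ℕ) (c : subgroupH1 κ.kerSubgroup M), (T ^ (j + 1)) c = (T ^ j) (T c) := fun j c => by
    rw [pow_succ, AddMonoid.End.coe_mul, Function.comp_apply]
  have hTpow : ∀ (N : ℕ) (c : subgroupH1 κ.kerSubgroup M), (T ^ p ^ N) c = conjH1 κ.kerSubgroup M (γ ^ p ^ N) c - c := by
    intro N c
    rw [hT, sub_one_pow_prime_pow_apply_of_torsion p Φ N (hSp c), conjH1_pow_eq_pow_apply κ.kerSubgroup γ Φ (fun _ => rfl)]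
  -- the kernel chain `Kc j = S ∩ ker T^j`
  let Kc : ℕ → AddSubgroup (subgroupH1 κ.kerSubgroup M) := fun j =>
    { carrier := {c | c ∈ S ∧ (T ^ j) c = 0}
      add_mem' := fun {x y} hx hy => ⟨S.add_mem hx.1 hy.1, by rw [map_add, hx.2, hy.2, add_zero]⟩
      zero_mem' := ⟨S.zero_mem, map_zero _⟩
      neg_mem' := fun {x} hx => ⟨S.neg_mem hx.1, by rw [map_neg, hx.2, neg_zero]⟩ }
  have hmemKc : ∀ j c, c ∈ Kc j ↔ c ∈ S ∧ (T ^ j) c = 0 := fun j c => Iff.rfl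
  have hmono : ∀ j, Kc j ≤ Kc (j + 1) := by
    intro j c hc
    rw [hmemKc] at hc ⊢
    exact ⟨hc.1, by rw [hTsucc, hc.2, map_zero]⟩
  have hstab : ∀ j, Kc j = Kc (j + 1) → Kc (j + 1) = Kc (j + 2) := by
    intro j heq
    refine le_antisymm (hmono (j + 1)) fun c hc => ?_
    rw [hmemKc] at hc
    have hTc : T c ∈ Kc (j + 1) := by
      rw [hmemKc]
      exact ⟨hTmem c hc.1, by rw [← hTsucc']; exact hc.2⟩
    rw [← heq, hmemKc] at hTc
    rw [hmemKc]
    exact ⟨hc.1, by rw [hTsucc']; exact hTc.2⟩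
  have hKcsub : ∀ N, (Kc (p ^ N) : Set (subgroupH1 κ.kerSubgroup M)) ⊆
      {c : subgroupH1 κ.kerSubgroup M | c ∈ S ∧ conjH1 κ.kerSubgroup M (γ ^ p ^ N) c = c} := by
    intro N c hc
    rw [SetLike.mem_coe, hmemKc] at hc
    refine ⟨hc.1, ?_⟩
    have h := hTpow N c
    rw [hc.2] at h
    exact (sub_eq_zero.1 h.symm).symm ▸ rfl
  have hfinKc : ∀ j, (Kc j : Set (subgroupH1 κ.kerSubgroup M)).Finite := by
    intro j
    set N := max j n₀ with hN
    have hjN : j ≤ p ^ N := (le_max_left j n₀).trans (Nat.lt_pow_self hpr.one_lt).le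
    have hmono' : Monotone Kc := monotone_nat_of_le_succ hmono
    exact ((hupper N (le_max_right j n₀)).1.subset (hKcsub N)).subset (hmono' hjN)
  -- exhaustion: every class of `S` is killed by some `T^{p^N}`
  have hexh : ∀ c ∈ (S : Set (subgroupH1 κ.kerSubgroup M)), ∃ j, c ∈ Kc j := by
    intro c hc
    have hstab' : ∀ m : M,
        IsOpen (MulAction.stabilizer (absoluteGaloisGroup K) m : Set (absoluteGaloisGroup K)) := by
      intro m
      have : (MulAction.stabilizer (absoluteGaloisGroup K) m : Set (absoluteGaloisGroup K)) =
          (fun g : absoluteGaloisGroup K => g • m) ⁻¹' {m} := by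
        ext g; simp [MulAction.mem_stabilizer_iff]
      rw [this]
      exact (isOpen_discrete {m}).preimage (hcont m)
    obtain ⟨N, hN⟩ := exists_conjH1_pow_prime_pow_eq κ M hstab' hγ c
    refine ⟨p ^ N, ?_⟩
    rw [hmemKc]
    exact ⟨hc, by rw [hTpow N c, hN, sub_self]⟩
  -- LOWER BOUND versus the layer bound
  by_contra hinf
  have hlow : ∀ j, 2 ^ j ≤ Nat.card (Kc j) := two_pow_le_card_of_chain Kc hmono hstab hfinKc hinf hexh
  obtain ⟨N, hN, hlt⟩ := exists_le_and_mul_add_lt_two_pow (p * a) (p * b) n₀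
  have h1 : 2 ^ p ^ N ≤ p ^ (a * N + b) := by
    refine (hlow (p ^ N)).trans ?_
    haveI : Finite {c : subgroupH1 κ.kerSubgroup M | c ∈ S ∧ conjH1 κ.kerSubgroup M (γ ^ p ^ N) c = c} := (hupper N hN).1.to_subtype
    exact (Nat.card_mono (Set.toFinite _) (hKcsub N)).trans (hupper N hN).2
  have h3 : p ^ (a * N + b) ≤ 2 ^ (p * (a * N + b)) := by
    calc p ^ (a * N + b) ≤ (2 ^ p) ^ (a * N + b) := Nat.pow_le_pow_left (Nat.lt_two_pow_self).le _
      _ = 2 ^ (p * (a * N + b)) := by rw [← pow_mul]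
  have h4 : p ^ N ≤ p * (a * N + b) := (Nat.pow_le_pow_iff_right (by norm_num : 1 < 2)).1 (h1.trans h3)
  have h5 : 2 ^ N ≤ p ^ N := Nat.pow_le_pow_left hpr.two_le N
  have h6 : p * (a * N + b) = p * a * N + p * b := by ring
  omega

end Tower

end Literature.NumberTheory.IwasawaTheory.ZpTowerFiniteOfLayerCardBound

end
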